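import Summits.CriticalPhenomena.PercolationContinuityZ3.Theorems.PercNearOneGluingNoHeavyLowerTailQ44bAntipodalReduction
import HarnessLib

/-!
# Antipodal fibres of `Q44b` are INTERSECTING: two counted colourings of one fibre always share a red free edge

Support file for crux `stmt-CriticalPhenomena-4575` (master-family programme; quadratic four-point row `Q44b`,
OPEN for all `n`), seat `prim-l12-p1` gen 8; memo
`run/shared/lean/prim/prim-l12/FROM-prim-l12-p1-g8-ANTIPODAL-INTERSECTING.md` §1.

Setting of `…Q44bAntipodalReduction`: bond configurations on the pairs of `Fin n`, four vertices `a b c y`, a fibre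
`(M, u)` (`u ∩ M = ∅`; a configuration `ω` of the fibre has `ω ∖ M = u`, its antipodal partner is `ω ∆ M`), and the
four (heavy, light) pairs of events of the row,
`(AC, ∅)`, `(AΔ, X)`, `(ab|c|y, C¬A)`, `(a|bcy, X′)` (`Q44b.evAC/evEmp`, `evAD/evX`, `evAB/evCnA`, `evPend/evXp`).
A configuration `ω` of the fibre is COUNTED (as a good or as a bad point of `Q44b.Antipodal`) when `ω` lies in a
heavy event and `ω ∆ M` in the light event OF THE SAME PAIR.

**Theorem** (`Q44b.fibre_points_meet`): two counted configurations `ω₁, ω₂` of the same fibre always share a free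
edge that is red in both: `(ω₁ ∩ ω₂ ∩ M).Nonempty`.  (So the typed configuration of an antipodal fibre — its bad
points of the nine types together with its goods — is an INTERSECTING family; in particular no two bad points are
disjoint, no good is disjoint from a bad point, and no bad point is empty.  This is the structural axiom that
distinguishes the antipodal instances needed for `Q44b` on a single weighted graph from general oriented (OTA)
instances; memo §1, §3.)

Proof: if `ω₁ ∩ ω₂ ∩ M = ∅` then `ω₂ ⊆ ω₁ ∆ M` and `ω₁ ⊆ ω₂ ∆ M` (`subset_symmDiff_of_disjoint`).  Every heavy
event forces `a~b` or (`b~c` and `b~y`) (`heavy_ab_or_bcy`), every light event forbids `a~b` (`light_not_ab`), and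
every light event except `C¬A` forbids `b~c ∧ b~y` (`light_not_bcy`); connectivity is monotone.  Hence `ω₂`'s
heavy pattern pushes `b~c~y` into the light partner `ω₁ ∆ M`, which must then lie in `C¬A`, whose heavy partner
`ab|c|y ∋ ω₁` has `a~b` — pushed into the light `ω₂ ∆ M`, contradiction.

Theorems only (no definitions, no named facts, no sorries); standard axioms.
-/

noncomputable section

namespace Summit.CriticalPhenomena.PercolationContinuityZ3.Theorems

namespace Q44b

open Set Literature.Probability.LatticeModels Literature.Probability.Percolation
open scoped Classical symmDiff

variable {n : ℕ}

/-! ### Connectivity content of the eight events -/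

/-- Every HEAVY event of the row (`AC`, `AΔ`, `ab|c|y`, `a|bcy`) forces `a~b`, or `b~c` together with `b~y`.
[this work] -/
theorem heavy_ab_or_bcy (a b c y : Fin n) {ω : BondConfig (Fin n)}
    (h : ω ∈ evAC a b c y ∨ ω ∈ evAD a b c y ∨ ω ∈ evAB a b c y ∨ ω ∈ evPend a b c y) :
    (openGraph ω).Reachable a b ∨ ((openGraph ω).Reachable b c ∧ (openGraph ω).Reachable b y) := by
  have mem : ∀ (ω : BondConfig (Fin n)) (u v : Fin n),
      ω ∈ (openConn u v : Set (BondConfig (Fin n))) ↔ (openGraph ω).Reachable u v := fun _ _ _ => Iff.rfl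
  rcases h with h | h | h | h
  · simp only [evAC, mem_inter_iff, mem] at h; exact Or.inl h.1
  · simp only [evAD, mem_inter_iff, mem_compl_iff, mem] at h; exact Or.inl h.1.1
  · simp only [evAB, mem_inter_iff, mem_compl_iff, mem] at h; exact Or.inl h.1.1.1
  · simp only [evPend, mem_inter_iff, mem_compl_iff, mem] at h; exact Or.inr ⟨h.1.2, h.2⟩

/-- Every LIGHT event of the row (`∅`, `X`, `C¬A`, `X′`) forbids `a~b`. [this work] -/
theorem light_not_ab (a b c y : Fin n) {ω : BondConfig (Fin n)}
    (h : ω ∈ evEmp a b c y ∨ ω ∈ evX a b c y ∨ ω ∈ evCnA a b c y ∨ ω ∈ evXp a b c y) :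
    ¬ (openGraph ω).Reachable a b := by
  have mem : ∀ (ω : BondConfig (Fin n)) (u v : Fin n),
      ω ∈ (openConn u v : Set (BondConfig (Fin n))) ↔ (openGraph ω).Reachable u v := fun _ _ _ => Iff.rfl
  rcases h with h | h | h | h
  · simp only [evEmp, mem_inter_iff, mem_compl_iff, mem] at h; exact h.1.1.1.1.1
  · simp only [evX, mem_inter_iff, mem_compl_iff, mem] at h; exact h.1
  · simp only [evCnA, mem_inter_iff, mem_compl_iff, mem] at h; exact h.2
  · simp only [evXp, mem_inter_iff, mem_compl_iff, mem] at h; exact h.1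

/-- The light events `∅`, `X`, `X′` forbid `b~c ∧ b~y` (only `C¬A ∋ a|bcy` allows it). [this work] -/
theorem light_not_bcy (a b c y : Fin n) {ω : BondConfig (Fin n)}
    (h : ω ∈ evEmp a b c y ∨ ω ∈ evX a b c y ∨ ω ∈ evXp a b c y)
    (hbc : (openGraph ω).Reachable b c) (hby : (openGraph ω).Reachable b y) : False := by
  have mem : ∀ (ω : BondConfig (Fin n)) (u v : Fin n),
      ω ∈ (openConn u v : Set (BondConfig (Fin n))) ↔ (openGraph ω).Reachable u v := fun _ _ _ => Iff.rfl
  rcases h with h | h | h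
  · simp only [evEmp, mem_inter_iff, mem_compl_iff, mem] at h; exact h.1.1.2 hbc
  · simp only [evX, mem_inter_iff, mem_compl_iff, mem_union, mem] at h
    rcases h.2 with ⟨hac, _⟩ | ⟨hay, _⟩
    · exact h.1 (hac.trans hbc.symm)
    · exact h.1 (hay.trans hby.symm)
  · simp only [evXp, mem_inter_iff, mem_compl_iff, mem_union, mem] at h
    rcases h.2 with ⟨⟨_, _⟩, hnby⟩ | ⟨⟨_, _⟩, hnbc⟩
    · exact hnby hby
    · exact hnbc hbc

/-- `C¬A` is disjoint from the other three light events. [this work] -/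
theorem not_CnA_of_light3 (a b c y : Fin n) {ω : BondConfig (Fin n)}
    (h : ω ∈ evEmp a b c y ∨ ω ∈ evX a b c y ∨ ω ∈ evXp a b c y) : ω ∉ evCnA a b c y := by
  have mem : ∀ (ω : BondConfig (Fin n)) (u v : Fin n),
      ω ∈ (openConn u v : Set (BondConfig (Fin n))) ↔ (openGraph ω).Reachable u v := fun _ _ _ => Iff.rfl
  intro hC
  simp only [evCnA, mem_inter_iff, mem_compl_iff, mem] at hC
  obtain ⟨hcy, hab⟩ := hC
  rcases h with h | h | h
  · simp only [evEmp, mem_inter_iff, mem_compl_iff, mem] at h; exact h.2 hcy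
  · simp only [evX, mem_inter_iff, mem_compl_iff, mem_union, mem] at h
    rcases h.2 with ⟨hac, hby⟩ | ⟨hay, hbc⟩
    · exact hab ((hac.trans hcy).trans hby.symm)
    · exact hab ((hay.trans hcy.symm).trans hbc.symm)
  · simp only [evXp, mem_inter_iff, mem_compl_iff, mem_union, mem] at h
    rcases h.2 with ⟨⟨hac, hnay⟩, _⟩ | ⟨⟨hay, hnac⟩, _⟩
    · exact hnay (hac.trans hcy)
    · exact hnac (hay.trans hcy.symm)

/-! ### The intersection theorem -/

/-- Set algebra of a fibre: two configurations of the fibre `(M,u)` with no common red free edge are each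
contained in the other's antipodal partner. [this work] -/
theorem subset_symmDiff_of_disjoint {M u ω₁ ω₂ : Set (Sym2 (Fin n))}
    (h₁ : ω₁ \ M = u) (h₂ : ω₂ \ M = u) (hd : ω₁ ∩ ω₂ ∩ M = ∅) : ω₂ ⊆ ω₁ ∆ M := by
  intro x hx
  rw [Set.mem_symmDiff]
  by_cases hxM : x ∈ M
  · right
    refine ⟨hxM, fun hx1 => ?_⟩
    have : x ∈ ω₁ ∩ ω₂ ∩ M := ⟨⟨hx1, hx⟩, hxM⟩
    rw [hd] at this
    exact this
  · left
    have hxu : x ∈ u := by rw [← h₂]; exact ⟨hx, hxM⟩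
    rw [← h₁] at hxu
    exact ⟨hxu.1, hxM⟩

/-- The core contradiction: configurations `ω₁ ⊆ β₂`, `ω₂ ⊆ β₁` with `ω₂` heavy and `β₁, β₂` light, where the
light `β₁`, if it lies in `C¬A`, has its heavy partner `ω₁` in `ab|c|y`. [this work] -/
theorem false_of_cross_contained (a b c y : Fin n) {ω₁ ω₂ β₁ β₂ : BondConfig (Fin n)}
    (hA₂ : ω₂ ∈ evAC a b c y ∨ ω₂ ∈ evAD a b c y ∨ ω₂ ∈ evAB a b c y ∨ ω₂ ∈ evPend a b c y)
    (hB₁ : β₁ ∈ evEmp a b c y ∨ β₁ ∈ evX a b c y ∨ β₁ ∈ evCnA a b c y ∨ β₁ ∈ evXp a b c y)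
    (hB₂ : β₂ ∈ evEmp a b c y ∨ β₂ ∈ evX a b c y ∨ β₂ ∈ evCnA a b c y ∨ β₂ ∈ evXp a b c y)
    (hP₁ : β₁ ∈ evCnA a b c y → ω₁ ∈ evAB a b c y)
    (s₂₁ : ω₂ ⊆ β₁) (s₁₂ : ω₁ ⊆ β₂) : False := by
  have mem : ∀ (ω : BondConfig (Fin n)) (u v : Fin n),
      ω ∈ (openConn u v : Set (BondConfig (Fin n))) ↔ (openGraph ω).Reachable u v := fun _ _ _ => Iff.rfl
  -- `ω₂` cannot join `a~b` (it sits inside the light `β₁`), so it joins `b~c~y`, hence so does `β₁`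
  have hbcy₁ : (openGraph β₁).Reachable b c ∧ (openGraph β₁).Reachable b y := by
    rcases heavy_ab_or_bcy a b c y hA₂ with hab | ⟨hbc, hby⟩
    · exact absurd (hab.mono (BHK2006.openGraph_le s₂₁)) (light_not_ab a b c y hB₁)
    · exact ⟨hbc.mono (BHK2006.openGraph_le s₂₁), hby.mono (BHK2006.openGraph_le s₂₁)⟩
  -- so `β₁ ∈ C¬A`
  have hC₁ : β₁ ∈ evCnA a b c y := by
    rcases hB₁ with h | h | h | h
    · exact (light_not_bcy a b c y (Or.inl h) hbcy₁.1 hbcy₁.2).elim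
    · exact (light_not_bcy a b c y (Or.inr (Or.inl h)) hbcy₁.1 hbcy₁.2).elim
    · exact h
    · exact (light_not_bcy a b c y (Or.inr (Or.inr h)) hbcy₁.1 hbcy₁.2).elim
  -- its heavy partner `ω₁ ∈ ab|c|y` joins `a~b`, pushed into the light `β₂`: contradiction
  have hAB₁ := hP₁ hC₁
  have hab₁ : (openGraph ω₁).Reachable a b := by
    simp only [evAB, mem_inter_iff, mem_compl_iff, mem] at hAB₁; exact hAB₁.1.1.1
  exact light_not_ab a b c y hB₂ (hab₁.mono (BHK2006.openGraph_le s₁₂))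

/-- **Antipodal fibres are intersecting.**  In the fibre `(M, u)`, let `ω₁, ω₂` be two COUNTED configurations:
`ωᵢ ∖ M = u`, `ωᵢ` in a heavy event and `ωᵢ ∆ M` in the light event of the same pair, the pair being any of
`(AC, ∅)`, `(AΔ, X)`, `(ab|c|y, C¬A)`, `(a|bcy, X′)` (goods and the nine bad types of `Q44b.Antipodal`).  Then
`ω₁` and `ω₂` share a red free edge: `(ω₁ ∩ ω₂ ∩ M).Nonempty`. [this work] -/
theorem fibre_points_meet (a b c y : Fin n) {M u ω₁ ω₂ : Set (Sym2 (Fin n))}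
    {H₁ L₁ H₂ L₂ : Set (BondConfig (Fin n))}
    (hp₁ : (H₁, L₁) = (evAC a b c y, evEmp a b c y) ∨ (H₁, L₁) = (evAD a b c y, evX a b c y) ∨
      (H₁, L₁) = (evAB a b c y, evCnA a b c y) ∨ (H₁, L₁) = (evPend a b c y, evXp a b c y))
    (hp₂ : (H₂, L₂) = (evAC a b c y, evEmp a b c y) ∨ (H₂, L₂) = (evAD a b c y, evX a b c y) ∨
      (H₂, L₂) = (evAB a b c y, evCnA a b c y) ∨ (H₂, L₂) = (evPend a b c y, evXp a b c y))
    (h₁ : ω₁ \ M = u) (hA₁ : ω₁ ∈ H₁) (hB₁ : ω₁ ∆ M ∈ L₁)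
    (h₂ : ω₂ \ M = u) (hA₂ : ω₂ ∈ H₂) (hB₂ : ω₂ ∆ M ∈ L₂) :
    (ω₁ ∩ ω₂ ∩ M).Nonempty := by
  rw [Set.nonempty_iff_ne_empty]
  intro hd
  have s₂₁ : ω₂ ⊆ ω₁ ∆ M := subset_symmDiff_of_disjoint h₁ h₂ hd
  have hd' : ω₂ ∩ ω₁ ∩ M = ∅ := by rw [Set.inter_comm ω₂ ω₁]; exact hd
  have s₁₂ : ω₁ ⊆ ω₂ ∆ M := subset_symmDiff_of_disjoint h₂ h₁ hd'
  -- unpack the pair memberships into the generic heavy / light / partner facts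
  have gen : ∀ {H L : Set (BondConfig (Fin n))} {ω β : BondConfig (Fin n)},
      ((H, L) = (evAC a b c y, evEmp a b c y) ∨ (H, L) = (evAD a b c y, evX a b c y) ∨
        (H, L) = (evAB a b c y, evCnA a b c y) ∨ (H, L) = (evPend a b c y, evXp a b c y)) →
      ω ∈ H → β ∈ L →
      (ω ∈ evAC a b c y ∨ ω ∈ evAD a b c y ∨ ω ∈ evAB a b c y ∨ ω ∈ evPend a b c y) ∧
      (β ∈ evEmp a b c y ∨ β ∈ evX a b c y ∨ β ∈ evCnA a b c y ∨ β ∈ evXp a b c y) ∧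
      (β ∈ evCnA a b c y → ω ∈ evAB a b c y) := by
    intro H L ω β hp hω hβ
    rcases hp with hp | hp | hp | hp <;> obtain ⟨rfl, rfl⟩ := Prod.mk.inj hp
    · exact ⟨Or.inl hω, Or.inl hβ, fun hC => (not_CnA_of_light3 a b c y (Or.inl hβ) hC).elim⟩
    · exact ⟨Or.inr (Or.inl hω), Or.inr (Or.inl hβ),
        fun hC => (not_CnA_of_light3 a b c y (Or.inr (Or.inl hβ)) hC).elim⟩
    · exact ⟨Or.inr (Or.inr (Or.inl hω)), Or.inr (Or.inr (Or.inl hβ)), fun _ => hω⟩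
    · exact ⟨Or.inr (Or.inr (Or.inr hω)), Or.inr (Or.inr (Or.inr hβ)),
        fun hC => (not_CnA_of_light3 a b c y (Or.inr (Or.inr hβ)) hC).elim⟩
  obtain ⟨_, gB₁, gP₁⟩ := gen hp₁ hA₁ hB₁
  obtain ⟨gA₂, gB₂, _⟩ := gen hp₂ hA₂ hB₂
  exact false_of_cross_contained a b c y gA₂ gB₁ gB₂ gP₁ s₂₁ s₁₂

/-- Corollary: a counted configuration has at least one red free edge (`ω ∩ M ≠ ∅`; take `ω₁ = ω₂`).
[this work] -/
theorem fibre_point_nonempty (a b c y : Fin n) {M u ω : Set (Sym2 (Fin n))}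
    {H L : Set (BondConfig (Fin n))}
    (hp : (H, L) = (evAC a b c y, evEmp a b c y) ∨ (H, L) = (evAD a b c y, evX a b c y) ∨
      (H, L) = (evAB a b c y, evCnA a b c y) ∨ (H, L) = (evPend a b c y, evXp a b c y))
    (h : ω \ M = u) (hA : ω ∈ H) (hB : ω ∆ M ∈ L) : (ω ∩ M).Nonempty := by
  have := fibre_points_meet a b c y hp hp h hA hB h hA hB
  rw [Set.inter_self] at this
  exact this

end Q44b

end Summit.CriticalPhenomena.PercolationContinuityZ3.Theorems

end
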